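import Mathlib
import Summits.ValiantsHypothesis.ValiantsHypothesis.Theorems.RigidityForcesSymmetryRankRigidMinimalReprLaplaceDefs
import Summits.ValiantsHypothesis.ValiantsHypothesis.Theorems.RigidityForcesSymmetryRankRigidMinimalReprLaplaceFourBorder

/-!
# The (4,2) catalogue in closed form: non-Laplace honest six-term decompositions of the permutation pattern `P₄`
# and the border classes B / A′ of the I1/I3 instruments
# (helper for support item `PolyaContinued.StrengthTwoPerFour`, stmt-ValiantsHypothesis-25160 — nothing here claims it)

Data format of `RigidityForcesSymmetryRankRigidMinimalRepr.LaplaceOptimal 4` (`…LaplaceDefs.lean`; `laplaceOptimal_four` p597028: every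
decomposition of `P₄(v) = [v : Fin 4 → Fin 4 injective]` into split-rank-one terms `u(v|_S)·w(v|_Sᶜ)` has Laplace weight
`Σ |S|!(4-|S|)! ≥ 24`; `laplaceOptimal_four_border` p565898: `P₄ + εE` is FIVE size-2 terms, weight 20).  Size-2 splits: `a = {0,1}|{2,3}`,
`b = {0,2}|{1,3}`, `g = {0,3}|{1,2}` (slots = rows, letters = columns of `per₄`; an `N`-term size-2 decomposition is exactly a ROW-SPLIT
identity `per₄ = Σ_{i<N} pᵢqᵢ`, cf. `…PolyaContinuedStrengthTwoPerFourRowSplit.lean` p628233).  Letters: `N = e₀₂+e₂₀`, `A = e₀₂-e₂₀`,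
`K = e₁₃+e₃₁`, `A' = e₁₃-e₃₁`, `S = e₀₁+e₁₀`, `L = e₂₃+e₃₂`, `M^{xy} = e_{xy}+e_{yx}`, `E^{xx} = e_{xx}`; `X_{ij} = X(v_i,v_j)`,
`(a,b,c,d) = (v₀,v₁,v₂,v₃)`.  This file gives, as integer identities on all `4⁴` assignments (plain `decide`) and — for the main one —
in the official format over `ℂ`, the CLOSED FORMS of everything the numerical instruments I1 (engine-2 g0, evidence #24 on the item)
and I3 rung 1 (engine-2 g2, evidence #28) observed at `(n,k) = (4,2)`:

* `border_error_eq_splitRankOne`, `honest411_family`: the border identity's error `E = -K₀₂K₁₃ + K₀₃K₁₂` equals `A'₀₁A'₂₃`, ONE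
  split-rank-one term (K-Plücker, `kPlucker_coeff_zero`); hence p565898's five terms plus `-εA'₀₁A'₂₃` are an HONEST six-term
  decomposition of `P₄`, split pattern `(4,1,1)`, weight exactly `24`, for every `ε ≠ 0` — border width five is honest width six with
  one term tending to `0`; `ε = 1`: `honest411_coeff` (I1's non-Laplace Gram type `(1⁴,½⁸)`).
* `honest321_coeff`: pattern `(3,2,1)` (I1's type `(1⁸,½⁴)`): the `(4,1,1)` identity with the decomposable tensor `4·e₂⊗e₀⊗e₃⊗e₁`
  moved from the `a`-group (whose flattening rank drops to 3) to the `b`-group.  So the EQUALITY CASE of `laplaceOptimal_four` is not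
  «row Laplace (one split) or column Laplace (pattern (2,2,2), `laplace_coeff_one`)»: it contains mixed positive-dimensional families.
* `classB_coeff_zero/one/two`: border class B (tail exponent `-½`) = SECOND-ORDER degeneration
  `ε²P₄ + ε³E₁ + ε⁴E₂ = (e₀₂+εe₂₀+ε²K)₀₂(⋯)₁₃ - (e₀₂-εe₂₀-ε²K)₀₃(⋯)₁₂ - ε(N-εK)₀₁(N-εK)₂₃ + ε²M¹²₀₁M⁰³₂₃ + ε²M²³₀₁M⁰¹₂₃`
  (`E₁ = [e₂₀⊗K+K⊗e₂₀]_b - [e₂₀⊗K+K⊗e₂₀]_g - K₀₁K₂₃`, `E₂ = K₀₂K₁₃ - K₀₃K₁₂`; the `ε⁰,ε¹,ε²` coefficients are the three theorems).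
* `classAprime_coeff_zero/one`: border class A′ (rank-10 direction, all five terms divergent, pattern `(2,2,1)`):
  `εP₄ + ε²E' = -(S-εL)₀₁(S-εL)₂₃ - 2E¹¹₀₁E⁰⁰₂₃ + (e₀₁)₀₂(e₁₀-e₀₁+εL)₁₃ + (e₁₀+εL)₀₂(S+εL)₁₃ + (S+εL)₀₃(S+εL)₁₂`, `E' = 2(e₂₂₃₃+e₃₃₂₂)`.

With class A = `laplaceOptimal_four_border` this is the complete list of border directions and honest Gram types reported by I1/I3.
HONEST FRAMING: positive-side identities and border calibrations only; `StrengthTwoPerFour` («no five products of quadrics give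
per₄») is neither proved nor refuted nor claimed; `LaplaceOptimal 4` and its border file are untouched; VP ≠ VNP is NOT proved.
-/

set_option autoImplicit false

-- the mandated summit-side namespace repeats a component by design (single-problem summit)
set_option linter.dupNamespace false

namespace Summit.ValiantsHypothesis.ValiantsHypothesis.Theorems.PolyaContinuedStrengthTwoPerFour.Catalogue

open RigidityForcesSymmetryRankRigidMinimalRepr.LaplaceFourBorder (injective_iff_pairwise laplace_coeff_one plucker_coeff_zero)

/-! ## §1  The border error term is one split-rank-one term; the honest `(4,1,1)` identity -/

/-- The three-term Plücker relation for the letters `1, 3`: `-A'₀₁A'₂₃ - K₀₂K₁₃ + K₀₃K₁₂ = 0` (`A' = e₁₃ - e₃₁`, `K = e₁₃ + e₃₁`),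
on all `4⁴` assignments `(a,b,c,d) = (v₀,v₁,v₂,v₃)`. -/
theorem kPlucker_coeff_zero : ∀ a b c d : Fin 4,
    -((if a = 1 ∧ b = 3 then (1 : ℤ) else if a = 3 ∧ b = 1 then -1 else 0) *
        (if c = 1 ∧ d = 3 then (1 : ℤ) else if c = 3 ∧ d = 1 then -1 else 0))
      - (if (a = 1 ∧ c = 3) ∨ (a = 3 ∧ c = 1) then (1 : ℤ) else 0) *
          (if (b = 1 ∧ d = 3) ∨ (b = 3 ∧ d = 1) then (1 : ℤ) else 0)
      + (if (a = 1 ∧ d = 3) ∨ (a = 3 ∧ d = 1) then (1 : ℤ) else 0) *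
          (if (b = 1 ∧ c = 3) ∨ (b = 3 ∧ c = 1) then (1 : ℤ) else 0) = 0 := by
  decide

/-- **The error term of `laplaceOptimal_four_border` is one split-rank-one term.**  With `K = e₁₃ + e₃₁`, `A' = e₁₃ - e₃₁`:
`E(v) = -K(v₀,v₂)K(v₁,v₃) + K(v₀,v₃)K(v₁,v₂) = A'(v₀,v₁) · A'(v₂,v₃)` — a single term across the split `{0,1}|{2,3}`.  So the five-term
border family of p565898 plus the sixth term `-ε·A'₀₁A'₂₃` is an honest decomposition of `P₄` for every `ε ≠ 0` (`honest411_family`). -/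
theorem border_error_eq_splitRankOne : ∀ a b c d : Fin 4,
    -((if (a = 1 ∧ c = 3) ∨ (a = 3 ∧ c = 1) then (1 : ℤ) else 0) * (if (b = 1 ∧ d = 3) ∨ (b = 3 ∧ d = 1) then (1 : ℤ) else 0))
      + (if (a = 1 ∧ d = 3) ∨ (a = 3 ∧ d = 1) then (1 : ℤ) else 0) * (if (b = 1 ∧ c = 3) ∨ (b = 3 ∧ c = 1) then (1 : ℤ) else 0)
      = (if a = 1 ∧ b = 3 then (1 : ℤ) else if a = 3 ∧ b = 1 then -1 else 0) *
          (if c = 1 ∧ d = 3 then (1 : ℤ) else if c = 3 ∧ d = 1 then -1 else 0) := by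
  decide

/-- **The honest `(4,1,1)` identity at `ε = 1`** (I1's non-Laplace Gram type `(1⁴, ½⁸)`):
`N₀₁K₂₃ + K₀₁N₂₃ - A₀₁A₂₃ - A'₀₁A'₂₃ - (N-K)₀₂(N-K)₁₃ + (N+K)₀₃(N+K)₁₂ = P₄` — six split-rank-one terms of size-2 splits, four across
`{0,1}|{2,3}`, one across `{0,2}|{1,3}`, one across `{0,3}|{1,2}`; weight `6·4 = 24`; pattern as the pairwise-distinctness indicator. -/
theorem honest411_coeff : ∀ a b c d : Fin 4,
    (if (a = 0 ∧ b = 2) ∨ (a = 2 ∧ b = 0) then (1 : ℤ) else 0) * (if (c = 1 ∧ d = 3) ∨ (c = 3 ∧ d = 1) then (1 : ℤ) else 0)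
      + (if (a = 1 ∧ b = 3) ∨ (a = 3 ∧ b = 1) then (1 : ℤ) else 0) * (if (c = 0 ∧ d = 2) ∨ (c = 2 ∧ d = 0) then (1 : ℤ) else 0)
      - (if a = 0 ∧ b = 2 then (1 : ℤ) else if a = 2 ∧ b = 0 then -1 else 0) *
          (if c = 0 ∧ d = 2 then (1 : ℤ) else if c = 2 ∧ d = 0 then -1 else 0)
      - (if a = 1 ∧ b = 3 then (1 : ℤ) else if a = 3 ∧ b = 1 then -1 else 0) *
          (if c = 1 ∧ d = 3 then (1 : ℤ) else if c = 3 ∧ d = 1 then -1 else 0)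
      - ((if (a = 0 ∧ c = 2) ∨ (a = 2 ∧ c = 0) then (1 : ℤ) else 0) - (if (a = 1 ∧ c = 3) ∨ (a = 3 ∧ c = 1) then (1 : ℤ) else 0)) *
          ((if (b = 0 ∧ d = 2) ∨ (b = 2 ∧ d = 0) then (1 : ℤ) else 0) - (if (b = 1 ∧ d = 3) ∨ (b = 3 ∧ d = 1) then (1 : ℤ) else 0))
      + ((if (a = 0 ∧ d = 2) ∨ (a = 2 ∧ d = 0) then (1 : ℤ) else 0) + (if (a = 1 ∧ d = 3) ∨ (a = 3 ∧ d = 1) then (1 : ℤ) else 0)) *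
          ((if (b = 0 ∧ c = 2) ∨ (b = 2 ∧ c = 0) then (1 : ℤ) else 0) + (if (b = 1 ∧ c = 3) ∨ (b = 3 ∧ c = 1) then (1 : ℤ) else 0))
      = if (a ≠ b ∧ a ≠ c ∧ a ≠ d ∧ b ≠ c ∧ b ≠ d ∧ c ≠ d) then 1 else 0 := by
  decide

/-! ## §2  The honest `(3,2,1)` identity -/

/-- **The honest `(3,2,1)` identity at `t = 1`** (I1's non-Laplace Gram type `(1⁸, ½⁴)`):
`K₀₁N₂₃ + (N-A-A')₀₁A'₂₃ + A₀₁(K-A)₂₃ - (N-K)₀₂(N-K)₁₃ + 4·(e₂₃)₀₂(e₀₁)₁₃ + (N+K)₀₃(N+K)₁₂ = P₄` — three terms across `{0,1}|{2,3}`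
(their sum has flattening rank `3`: it is the `a`-group of `honest411_coeff` minus the decomposable tensor `4·e₂⊗e₀⊗e₃⊗e₁`), two across
`{0,2}|{1,3}` (the `(4,1,1)` `b`-term plus that tensor, written as the `b`-term `4·e₂₃(v₀,v₂)e₀₁(v₁,v₃)`), one across `{0,3}|{1,2}`. -/
theorem honest321_coeff : ∀ a b c d : Fin 4,
    (if (a = 1 ∧ b = 3) ∨ (a = 3 ∧ b = 1) then (1 : ℤ) else 0) * (if (c = 0 ∧ d = 2) ∨ (c = 2 ∧ d = 0) then (1 : ℤ) else 0)
      + ((if (a = 0 ∧ b = 2) ∨ (a = 2 ∧ b = 0) then (1 : ℤ) else 0)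
          - (if a = 0 ∧ b = 2 then (1 : ℤ) else if a = 2 ∧ b = 0 then -1 else 0)
          - (if a = 1 ∧ b = 3 then (1 : ℤ) else if a = 3 ∧ b = 1 then -1 else 0)) *
          (if c = 1 ∧ d = 3 then (1 : ℤ) else if c = 3 ∧ d = 1 then -1 else 0)
      + (if a = 0 ∧ b = 2 then (1 : ℤ) else if a = 2 ∧ b = 0 then -1 else 0) *
          ((if (c = 1 ∧ d = 3) ∨ (c = 3 ∧ d = 1) then (1 : ℤ) else 0) - (if c = 0 ∧ d = 2 then (1 : ℤ) else if c = 2 ∧ d = 0 then -1 else 0))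
      - ((if (a = 0 ∧ c = 2) ∨ (a = 2 ∧ c = 0) then (1 : ℤ) else 0) - (if (a = 1 ∧ c = 3) ∨ (a = 3 ∧ c = 1) then (1 : ℤ) else 0)) *
          ((if (b = 0 ∧ d = 2) ∨ (b = 2 ∧ d = 0) then (1 : ℤ) else 0) - (if (b = 1 ∧ d = 3) ∨ (b = 3 ∧ d = 1) then (1 : ℤ) else 0))
      + 4 * (if a = 2 ∧ c = 3 then (1 : ℤ) else 0) * (if b = 0 ∧ d = 1 then (1 : ℤ) else 0)
      + ((if (a = 0 ∧ d = 2) ∨ (a = 2 ∧ d = 0) then (1 : ℤ) else 0) + (if (a = 1 ∧ d = 3) ∨ (a = 3 ∧ d = 1) then (1 : ℤ) else 0)) *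
          ((if (b = 0 ∧ c = 2) ∨ (b = 2 ∧ c = 0) then (1 : ℤ) else 0) + (if (b = 1 ∧ c = 3) ∨ (b = 3 ∧ c = 1) then (1 : ℤ) else 0))
      = if (a ≠ b ∧ a ≠ c ∧ a ≠ d ∧ b ≠ c ∧ b ≠ d ∧ c ≠ d) then 1 else 0 := by
  decide

/-! ## §3  Border class B: the second-order degeneration (coefficient identities) -/

/-- Class B, `ε⁰` coefficient: the two decomposable cores cancel, `e₀₂(v₀,v₂)e₀₂(v₁,v₃) - e₀₂(v₀,v₃)e₀₂(v₁,v₂) = 0`. -/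
theorem classB_coeff_zero : ∀ a b c d : Fin 4,
    (if a = 0 ∧ c = 2 then (1 : ℤ) else 0) * (if b = 0 ∧ d = 2 then (1 : ℤ) else 0)
      - (if a = 0 ∧ d = 2 then (1 : ℤ) else 0) * (if b = 0 ∧ c = 2 then (1 : ℤ) else 0) = 0 := by
  decide

/-- Class B, `ε¹` coefficient: the first-order cross terms of the two divergent terms sum to `N₀₁N₂₃`, which the `ε⁻¹`-divergent
`a`-term cancels: `[e₀₂⊗e₂₀ + e₂₀⊗e₀₂]_b + [e₀₂⊗e₂₀ + e₂₀⊗e₀₂]_g - N₀₁N₂₃ = 0`. -/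
theorem classB_coeff_one : ∀ a b c d : Fin 4,
    (if a = 0 ∧ c = 2 then (1 : ℤ) else 0) * (if b = 2 ∧ d = 0 then (1 : ℤ) else 0)
      + (if a = 2 ∧ c = 0 then (1 : ℤ) else 0) * (if b = 0 ∧ d = 2 then (1 : ℤ) else 0)
      + (if a = 0 ∧ d = 2 then (1 : ℤ) else 0) * (if b = 2 ∧ c = 0 then (1 : ℤ) else 0)
      + (if a = 2 ∧ d = 0 then (1 : ℤ) else 0) * (if b = 0 ∧ c = 2 then (1 : ℤ) else 0)
      - (if (a = 0 ∧ b = 2) ∨ (a = 2 ∧ b = 0) then (1 : ℤ) else 0) * (if (c = 0 ∧ d = 2) ∨ (c = 2 ∧ d = 0) then (1 : ℤ) else 0)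
      = 0 := by
  decide

/-- Class B, `ε²` coefficient = the pattern: `[e₀₂⊗K + e₂₀⊗e₂₀ + K⊗e₀₂]_b + [e₀₂⊗K - e₂₀⊗e₂₀ + K⊗e₀₂]_g + N₀₁K₂₃ + K₀₁N₂₃
+ M¹²₀₁M⁰³₂₃ + M²³₀₁M⁰¹₂₃ = P₄` (the first two brackets are the eight permutations with `0 ∈ {v₀,v₁}` and `2 ∈ {v₂,v₃}`, the last two
terms the eight with `2 ∈ {v₀,v₁}` and `0 ∈ {v₂,v₃}`). -/
theorem classB_coeff_two : ∀ a b c d : Fin 4,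
    (if a = 0 ∧ c = 2 then (1 : ℤ) else 0) * (if (b = 1 ∧ d = 3) ∨ (b = 3 ∧ d = 1) then (1 : ℤ) else 0)
      + (if a = 2 ∧ c = 0 then (1 : ℤ) else 0) * (if b = 2 ∧ d = 0 then (1 : ℤ) else 0)
      + (if (a = 1 ∧ c = 3) ∨ (a = 3 ∧ c = 1) then (1 : ℤ) else 0) * (if b = 0 ∧ d = 2 then (1 : ℤ) else 0)
      + (if a = 0 ∧ d = 2 then (1 : ℤ) else 0) * (if (b = 1 ∧ c = 3) ∨ (b = 3 ∧ c = 1) then (1 : ℤ) else 0)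
      - (if a = 2 ∧ d = 0 then (1 : ℤ) else 0) * (if b = 2 ∧ c = 0 then (1 : ℤ) else 0)
      + (if (a = 1 ∧ d = 3) ∨ (a = 3 ∧ d = 1) then (1 : ℤ) else 0) * (if b = 0 ∧ c = 2 then (1 : ℤ) else 0)
      + (if (a = 0 ∧ b = 2) ∨ (a = 2 ∧ b = 0) then (1 : ℤ) else 0) * (if (c = 1 ∧ d = 3) ∨ (c = 3 ∧ d = 1) then (1 : ℤ) else 0)
      + (if (a = 1 ∧ b = 3) ∨ (a = 3 ∧ b = 1) then (1 : ℤ) else 0) * (if (c = 0 ∧ d = 2) ∨ (c = 2 ∧ d = 0) then (1 : ℤ) else 0)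
      + (if (a = 1 ∧ b = 2) ∨ (a = 2 ∧ b = 1) then (1 : ℤ) else 0) * (if (c = 0 ∧ d = 3) ∨ (c = 3 ∧ d = 0) then (1 : ℤ) else 0)
      + (if (a = 2 ∧ b = 3) ∨ (a = 3 ∧ b = 2) then (1 : ℤ) else 0) * (if (c = 0 ∧ d = 1) ∨ (c = 1 ∧ d = 0) then (1 : ℤ) else 0)
      = if (a ≠ b ∧ a ≠ c ∧ a ≠ d ∧ b ≠ c ∧ b ≠ d ∧ c ≠ d) then 1 else 0 := by
  decide

/-! ## §4  Border class A′: five divergent terms (coefficient identities) -/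

/-- Class A′, `ε⁰` coefficient: the five-term relation `-S₀₁S₂₃ - 2E¹¹₀₁E⁰⁰₂₃ + (e₀₁)₀₂(e₁₀-e₀₁)₁₃ + (e₁₀)₀₂S₁₃ + S₀₃S₁₂ = 0`
among size-2 split-rank-one terms in the two-letter world `{0,1}` (`S = e₀₁ + e₁₀`, `E¹¹ = e₁₁`, `E⁰⁰ = e₀₀`). -/
theorem classAprime_coeff_zero : ∀ a b c d : Fin 4,
    -((if (a = 0 ∧ b = 1) ∨ (a = 1 ∧ b = 0) then (1 : ℤ) else 0) * (if (c = 0 ∧ d = 1) ∨ (c = 1 ∧ d = 0) then (1 : ℤ) else 0))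
      - 2 * (if a = 1 ∧ b = 1 then (1 : ℤ) else 0) * (if c = 0 ∧ d = 0 then (1 : ℤ) else 0)
      + (if a = 0 ∧ c = 1 then (1 : ℤ) else 0) * ((if b = 1 ∧ d = 0 then (1 : ℤ) else 0) - (if b = 0 ∧ d = 1 then (1 : ℤ) else 0))
      + (if a = 1 ∧ c = 0 then (1 : ℤ) else 0) * (if (b = 0 ∧ d = 1) ∨ (b = 1 ∧ d = 0) then (1 : ℤ) else 0)
      + (if (a = 0 ∧ d = 1) ∨ (a = 1 ∧ d = 0) then (1 : ℤ) else 0) * (if (b = 0 ∧ c = 1) ∨ (b = 1 ∧ c = 0) then (1 : ℤ) else 0)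
      = 0 := by
  decide

/-- Class A′, `ε¹` coefficient = the pattern (column-Laplace for the letter pairing `{0,1}|{2,3}`, `L = e₂₃ + e₃₂`):
`L₀₁S₂₃ + S₀₁L₂₃ + (e₀₁)₀₂L₁₃ + (e₁₀)₀₂L₁₃ + L₀₂S₁₃ + S₀₃L₁₂ + L₀₃S₁₂ = P₄`. -/
theorem classAprime_coeff_one : ∀ a b c d : Fin 4,
    (if (a = 2 ∧ b = 3) ∨ (a = 3 ∧ b = 2) then (1 : ℤ) else 0) * (if (c = 0 ∧ d = 1) ∨ (c = 1 ∧ d = 0) then (1 : ℤ) else 0)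
      + (if (a = 0 ∧ b = 1) ∨ (a = 1 ∧ b = 0) then (1 : ℤ) else 0) * (if (c = 2 ∧ d = 3) ∨ (c = 3 ∧ d = 2) then (1 : ℤ) else 0)
      + (if a = 0 ∧ c = 1 then (1 : ℤ) else 0) * (if (b = 2 ∧ d = 3) ∨ (b = 3 ∧ d = 2) then (1 : ℤ) else 0)
      + (if a = 1 ∧ c = 0 then (1 : ℤ) else 0) * (if (b = 2 ∧ d = 3) ∨ (b = 3 ∧ d = 2) then (1 : ℤ) else 0)
      + (if (a = 2 ∧ c = 3) ∨ (a = 3 ∧ c = 2) then (1 : ℤ) else 0) * (if (b = 0 ∧ d = 1) ∨ (b = 1 ∧ d = 0) then (1 : ℤ) else 0)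
      + (if (a = 0 ∧ d = 1) ∨ (a = 1 ∧ d = 0) then (1 : ℤ) else 0) * (if (b = 2 ∧ c = 3) ∨ (b = 3 ∧ c = 2) then (1 : ℤ) else 0)
      + (if (a = 2 ∧ d = 3) ∨ (a = 3 ∧ d = 2) then (1 : ℤ) else 0) * (if (b = 0 ∧ c = 1) ∨ (b = 1 ∧ c = 0) then (1 : ℤ) else 0)
      = if (a ≠ b ∧ a ≠ c ∧ a ≠ d ∧ b ≠ c ∧ b ≠ d ∧ c ≠ d) then 1 else 0 := by
  decide


/-! ## §5  The `(4,1,1)` family in the data format of `LaplaceOptimal 4` -/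

/-- **The honest `(4,1,1)` family: p565898's five border terms plus the sixth term `-ε·A'₀₁A'₂₃`.**  For every `ε ≠ 0`,
`-ε⁻¹A₀₁A₂₃ - ε⁻¹(N-εK)₀₂(N-εK)₁₃ + ε⁻¹(N+εK)₀₃(N+εK)₁₂ + K₀₁N₂₃ + N₀₁K₂₃ - εA'₀₁A'₂₃ = P₄` exactly: six split-rank-one terms of
weight `24` with splits `{0,1},{0,2},{0,3},{0,1},{0,1},{0,1}` (the first five are verbatim the terms of `laplaceOptimal_four_border`,
whose error `εE = ε·A'₀₁A'₂₃` the sixth term removes, `border_error_eq_splitRankOne`).  As `ε → 0` the sixth term tends to `0` and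
three others diverge: border width five of `P₄` is honest width six with one vanishing term.  (Letter scaling `K ↦ εK`, `A' ↦ εA'`
shows the family is one orbit of the letter torus; its balanced member is I1's Gram type `(1⁴, ½⁸)`.) -/
theorem honest411_family (ε : ℂ) (hε : ε ≠ 0) :
    ∃ (S : Fin 6 → Finset (Fin 4)) (u w : Fin 6 → (Fin 4 → Fin 4) → ℂ),
      S = ![{0, 1}, {0, 2}, {0, 3}, {0, 1}, {0, 1}, {0, 1}] ∧
      (∀ t, ∀ v v' : Fin 4 → Fin 4, (∀ i ∈ S t, v i = v' i) → u t v = u t v') ∧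
      (∀ t, ∀ v v' : Fin 4 → Fin 4, (∀ i, i ∉ S t → v i = v' i) → w t v = w t v') ∧
      (∑ t, (S t).card.factorial * (4 - (S t).card).factorial) = Nat.factorial 4 ∧
      ∀ v : Fin 4 → Fin 4, (∑ t, u t v * w t v) = if Function.Injective v then 1 else 0 := by
  classical
  let N : Fin 4 → Fin 4 → ℂ := fun x y => if (x = 0 ∧ y = 2) ∨ (x = 2 ∧ y = 0) then 1 else 0
  let A : Fin 4 → Fin 4 → ℂ := fun x y => if x = 0 ∧ y = 2 then 1 else if x = 2 ∧ y = 0 then -1 else 0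
  let K : Fin 4 → Fin 4 → ℂ := fun x y => if (x = 1 ∧ y = 3) ∨ (x = 3 ∧ y = 1) then 1 else 0
  let A' : Fin 4 → Fin 4 → ℂ := fun x y => if x = 1 ∧ y = 3 then 1 else if x = 3 ∧ y = 1 then -1 else 0
  let S : Fin 6 → Finset (Fin 4) := ![{0, 1}, {0, 2}, {0, 3}, {0, 1}, {0, 1}, {0, 1}]
  let u : Fin 6 → (Fin 4 → Fin 4) → ℂ := ![fun v => -ε⁻¹ * A (v 0) (v 1),
    fun v => -ε⁻¹ * (N (v 0) (v 2) - ε * K (v 0) (v 2)), fun v => ε⁻¹ * (N (v 0) (v 3) + ε * K (v 0) (v 3)),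
    fun v => K (v 0) (v 1), fun v => N (v 0) (v 1), fun v => -ε * A' (v 0) (v 1)]
  let w : Fin 6 → (Fin 4 → Fin 4) → ℂ := ![fun v => A (v 2) (v 3), fun v => N (v 1) (v 3) - ε * K (v 1) (v 3),
    fun v => N (v 1) (v 2) + ε * K (v 1) (v 2), fun v => N (v 2) (v 3), fun v => K (v 2) (v 3), fun v => A' (v 2) (v 3)]
  refine ⟨S, u, w, rfl, ?_, ?_, by decide, ?_⟩
  · intro t v v' h
    fin_cases t
    · have h0 := h 0 (by simp [S]); have h1 := h 1 (by simp [S]); simp [u, h0, h1]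
    · have h0 := h 0 (by simp [S]); have h1 := h 2 (by simp [S]); simp [u, h0, h1]
    · have h0 := h 0 (by simp [S]); have h1 := h 3 (by simp [S]); simp [u, h0, h1]
    · have h0 := h 0 (by simp [S]); have h1 := h 1 (by simp [S]); simp [u, h0, h1]
    · have h0 := h 0 (by simp [S]); have h1 := h 1 (by simp [S]); simp [u, h0, h1]
    · have h0 := h 0 (by simp [S]); have h1 := h 1 (by simp [S]); simp [u, h0, h1]
  · intro t v v' h
    fin_cases t
    · have h0 := h 2 (by simp [S]); have h1 := h 3 (by simp [S]); simp [w, h0, h1]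
    · have h0 := h 1 (by simp [S]); have h1 := h 3 (by simp [S]); simp [w, h0, h1]
    · have h0 := h 1 (by simp [S]); have h1 := h 2 (by simp [S]); simp [w, h0, h1]
    · have h0 := h 2 (by simp [S]); have h1 := h 3 (by simp [S]); simp [w, h0, h1]
    · have h0 := h 2 (by simp [S]); have h1 := h 3 (by simp [S]); simp [w, h0, h1]
    · have h0 := h 2 (by simp [S]); have h1 := h 3 (by simp [S]); simp [w, h0, h1]
  · intro v
    have h0 : -(A (v 0) (v 1) * A (v 2) (v 3)) - N (v 0) (v 2) * N (v 1) (v 3) + N (v 0) (v 3) * N (v 1) (v 2) = 0 := by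
      have := congrArg (Int.cast : ℤ → ℂ) (plucker_coeff_zero (v 0) (v 1) (v 2) (v 3))
      push_cast at this
      simpa [A, N, apply_ite (Int.cast : ℤ → ℂ)] using this
    have h1 : N (v 0) (v 2) * K (v 1) (v 3) + K (v 0) (v 2) * N (v 1) (v 3) + N (v 0) (v 3) * K (v 1) (v 2) + K (v 0) (v 3) * N (v 1) (v 2)
        + K (v 0) (v 1) * N (v 2) (v 3) + N (v 0) (v 1) * K (v 2) (v 3) = if Function.Injective v then 1 else 0 := by
      have := congrArg (Int.cast : ℤ → ℂ) (laplace_coeff_one (v 0) (v 1) (v 2) (v 3))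
      push_cast at this
      by_cases hv : Function.Injective v
      · rw [if_pos hv]
        rw [if_pos ((injective_iff_pairwise v).1 hv)] at this
        simpa [N, K, apply_ite (Int.cast : ℤ → ℂ)] using this
      · rw [if_neg hv]
        rw [if_neg (mt (injective_iff_pairwise v).2 hv)] at this
        simpa [N, K, apply_ite (Int.cast : ℤ → ℂ)] using this
    have h2 : -(K (v 0) (v 2) * K (v 1) (v 3)) + K (v 0) (v 3) * K (v 1) (v 2) = A' (v 0) (v 1) * A' (v 2) (v 3) := by
      have := congrArg (Int.cast : ℤ → ℂ) (border_error_eq_splitRankOne (v 0) (v 1) (v 2) (v 3))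
      push_cast at this
      simpa [K, A', apply_ite (Int.cast : ℤ → ℂ)] using this
    have hinv : ε⁻¹ * ε = 1 := inv_mul_cancel₀ hε
    rw [Fin.sum_univ_six]
    show u 0 v * w 0 v + u 1 v * w 1 v + u 2 v * w 2 v + u 3 v * w 3 v + u 4 v * w 4 v + u 5 v * w 5 v = _
    simp only [u, w, Matrix.cons_val]
    linear_combination ε⁻¹ * h0 + ((N (v 0) (v 2) * K (v 1) (v 3) + K (v 0) (v 2) * N (v 1) (v 3) + N (v 0) (v 3) * K (v 1) (v 2) + K (v 0) (v 3) * N (v 1) (v 2)) + ε * (-(K (v 0) (v 2) * K (v 1) (v 3)) + K (v 0) (v 3) * K (v 1) (v 2))) * hinv + h1 + ε * h2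

end Summit.ValiantsHypothesis.ValiantsHypothesis.Theorems.PolyaContinuedStrengthTwoPerFour.Catalogue
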